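import Summits.Ventures.PercRepro.S2DichotomyTools
import Summits.Ventures.PercRepro.S2TopCountCell
import Summits.Ventures.PercRepro.S2PhiSixteenFive
import Summits.Ventures.PercRepro.TriangleCapEightI
import Summits.Ventures.PercRepro.RankLevelSetFourCircuitNullityFour
import Summits.Ventures.PercRepro.S1FiveCircuitBase

/-!
# PercRepro — S2: THE CELL `(16, 8)` OF THE `q = 5` WINDOW BY THE NESTED DICHOTOMY (p7, gen 10; sub-claim S2; the `p = 16` row)

The kit's `(16, 8)` cell reads `1.147` (coloop-free) / `1.30` on the standard caps `13 / 99 / 651` (`TriangleCap.cq3 8`,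
`avgChain16 8`, `avgChain5b 8`; tail `T = 1,557,443 ⇒ m = 96`; with the exact `Φ(16, 5) ≤ 2^21/20905` the `(U)`-side must be
`≤ 151,561`). The NESTED DICHOTOMY on «a set `W` of nullity `k` on `≤ 5 + k` points», `k = 7, 6, 5, 4`, closes it with NO coloop split:
* `ν = 7` on `≤ 12` points: every coindependent `m`-set has `≥ m − 1` points in `W` — the top count size by size `≤ 39,039`;
* `ν = 6` on `≤ 11` points: `≥ m − 2` points in `W` — `≤ 132,693`;
* `ν = 5` on `≤ 10` points, no `ν = 6` on `≤ 11`: every rank-`5` set has `≤ 10` points and every rank-`4` set `≤ 9` (descent), the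
  `5`-set payment `V(10, 5) = 30,492` and the partition count at `f = 10` (`σ_m = 11/5`): `≤ 30,492 + 110,407 = 140,899`;
* `ν = 4` on `≤ 9` points, no `ν = 5` on `≤ 10`: `f = 9`, `f' = 8`, `σ_m = 9/5`: `≤ 39,501 + 90,333 = 129,834`;
* spread (no `ν = 4` on `≤ 9`): `f = 8`, `f' = 7`, `σ_m = 22/15`: `≤ C(24, 5) + C(13, 2) + (22/15)·50,185 = 116,187`.
**`ThmN.topCount_le_sixteen_eight`** (`#U(16, 5) ≤ 151,561`) and **`ThmN.c025_core_five_sixteen_eight (M) (hR : ρ(E) = 16)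
(hn : |E| = 24) (hfree) : RLS M 16 5`** — the cell `(16, 8)` in full. Axioms: standard.
-/

open scoped Matroid

namespace PercRepro

namespace ThmN

open Set

variable {α : Type}

/-- The standard caps at `(16, 8)`: `s₃ ≤ 13`, `s₄ ≤ 99`, `s₅ ≤ 651` on every `e`-free core of nullity `8`. -/
theorem caps_sixteen_eight (M : Matroid α) [M.Finite]
    (hd : M.E.encard = M.eRank + ((8 : ℕ) : ℕ∞))
    (hfree : ∀ e ∈ M.E, ∃ A ⊆ M.E \ {e}, e ∉ M.closure A ∧ e ∉ M.closure ((M.E \ {e}) \ A)) :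
    {C : Set α | M.IsCircuit C ∧ C.ncard = 3}.ncard ≤ 13 ∧
      {C : Set α | M.IsCircuit C ∧ C.ncard = 4}.ncard ≤ 99 ∧
        {C : Set α | M.IsCircuit C ∧ C.ncard = 5}.ncard ≤ 651 := by
  have hs3 := TriangleCap.core_ncard_triangles_le_cq3 M hfree hd
  rw [show TriangleCap.cq3 8 = 13 by decide] at hs3
  have hs4 := ncard_fourCircuits_le_avgChain16 8 M hfree hd
  rw [avgChain16_values.2.1] at hs4
  have hs5 := S1.ncard_fiveCircuits_le_avgChain5b 8 M hfree hd
  rw [S1.avgChain5b_values.2.1] at hs5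
  exact ⟨hs3, hs4, hs5⟩

/-- **The top count at `(16, 8)` by the nested dichotomy**: `#U(16, 5) ≤ 151,561` on every `e`-free core of rank `16` on `24`
points (the cases `ν = 7 / 6 / 5 / 4` on `≤ 12 / 11 / 10 / 9` points, then spread). -/
theorem topCount_le_sixteen_eight (M : Matroid α) [M.Finite]
    (hR : M.eRank = ((16 : ℕ) : ℕ∞)) (hn : M.E.ncard = 16 + 8)
    (hfree : ∀ e ∈ M.E, ∃ A ⊆ M.E \ {e}, e ∉ M.closure A ∧ e ∉ M.closure ((M.E \ {e}) \ A)) :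
    Matroid.topCount M 16 5 ≤ 151561 := by
  classical
  have hd : M.E.encard = M.eRank + ((8 : ℕ) : ℕ∞) := by
    rw [hR, ← M.ground_finite.cast_ncard_eq, hn]
    push_cast
    ring
  obtain ⟨hs3, hs4, hs5⟩ := caps_sixteen_eight M hd hfree
  -- the full payment from a set `W` of nullity `k`: the top count size by size
  have full : ∀ (k : ℕ) {W : Set α}, W ⊆ M.E → W.encard = M.eRk W + k →
      Matroid.topCount M 16 5 ≤ ∑ m ∈ Finset.Icc 5 8, ∑ j ∈ Finset.Icc (m + k - 8) m,
        W.ncard.choose j * (16 + 8 - W.ncard).choose (m - j) := by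
    intro k W hW hWk
    refine (S2.topCount_le_sum_spanning M hR hd 5).trans ?_
    refine Finset.sum_le_sum (fun m _ => ?_)
    have h := S2.ncard_spanning_compl_le_of_nullity M hW hd hWk (m := m)
    rw [hn] at h
    exact h
  by_cases h7 : ∃ W ⊆ M.E, W.ncard ≤ 12 ∧ W.encard = M.eRk W + 7
  · obtain ⟨W, hW, hWn, hWk⟩ := h7
    refine (full 7 hW hWk).trans ?_
    generalize W.ncard = w at hWn ⊢
    interval_cases w <;> decide
  by_cases h6 : ∃ W ⊆ M.E, W.ncard ≤ 11 ∧ W.encard = M.eRk W + 6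
  · obtain ⟨W, hW, hWn, hWk⟩ := h6
    refine (full 6 hW hWk).trans ?_
    generalize W.ncard = w at hWn ⊢
    interval_cases w <;> decide
  by_cases h5 : ∃ W ⊆ M.E, W.ncard ≤ 10 ∧ W.encard = M.eRk W + 5
  · obtain ⟨W, hW, hWn, hWk⟩ := h5
    -- no `ν = 6` on `≤ 11` points: rank-`5` sets `≤ 10`, rank-`4` sets `≤ 9`
    have hflat : ∀ X ⊆ M.E, M.eRk X ≤ 5 → X.ncard ≤ 10 := fun X hX hr => by
      have := S2.ncard_le_of_eRk_le_of_not_nullity M 6 11 (by norm_num) h6 hX (r := 5) (by norm_num) (by exact_mod_cast hr)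
      omega
    have hflat' : ∀ X ⊆ M.E, M.eRk X ≤ 4 → X.ncard ≤ 9 := fun X hX hr => by
      have := S2.ncard_le_of_eRk_le_of_not_nullity M 6 11 (by norm_num) h6 hX (r := 4) (by norm_num) (by exact_mod_cast hr)
      omega
    have hV := S2.ncard_spanning_compl_le_of_nullity M hW hd hWk (m := 5)
    have hV' : ∑ j ∈ Finset.Icc (5 + 5 - 8) 5, W.ncard.choose j * (M.E.ncard - W.ncard).choose (5 - j) ≤ 30492 := by
      rw [hn]
      generalize W.ncard = w at hWn ⊢
      interval_cases w <;> decide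
    have hU := topCount_le_payment_flat M 16 8 (by norm_num) hR hn hfree 10 9 hflat hflat' (by norm_num) (by norm_num)
      13 99 651 hs3 hs4 hs5 30492 (hV.trans hV')
    norm_num [Finset.sum_range_succ, Nat.choose] at hU
    exact hU.trans (by norm_num)
  by_cases h4 : ∃ W ⊆ M.E, W.ncard ≤ 9 ∧ W.encard = M.eRk W + 4
  · obtain ⟨W, hW, hWn, hWk⟩ := h4
    have hflat : ∀ X ⊆ M.E, M.eRk X ≤ 5 → X.ncard ≤ 9 := fun X hX hr => by
      have := S2.ncard_le_of_eRk_le_of_not_nullity M 5 10 (by norm_num) h5 hX (r := 5) (by norm_num) (by exact_mod_cast hr)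
      omega
    have hflat' : ∀ X ⊆ M.E, M.eRk X ≤ 4 → X.ncard ≤ 8 := fun X hX hr => by
      have := S2.ncard_le_of_eRk_le_of_not_nullity M 5 10 (by norm_num) h5 hX (r := 4) (by norm_num) (by exact_mod_cast hr)
      omega
    have hV := S2.ncard_spanning_compl_le_of_nullity M hW hd hWk (m := 5)
    have hV' : ∑ j ∈ Finset.Icc (5 + 4 - 8) 5, W.ncard.choose j * (M.E.ncard - W.ncard).choose (5 - j) ≤ 39501 := by
      rw [hn]
      generalize W.ncard = w at hWn ⊢
      interval_cases w <;> decide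
    have hU := topCount_le_payment_flat M 16 8 (by norm_num) hR hn hfree 9 8 hflat hflat' (by norm_num) (by norm_num)
      13 99 651 hs3 hs4 hs5 39501 (hV.trans hV')
    norm_num [Finset.sum_range_succ, Nat.choose] at hU
    exact hU.trans (by norm_num)
  · -- spread: rank-`5` sets `≤ 8`, rank-`4` sets `≤ 7`
    have hflat : ∀ X ⊆ M.E, M.eRk X ≤ 5 → X.ncard ≤ 8 := fun X hX hr => by
      have := S2.ncard_le_of_eRk_le_of_not_nullity M 4 9 (by norm_num) h4 hX (r := 5) (by norm_num) (by exact_mod_cast hr)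
      omega
    have hflat' : ∀ X ⊆ M.E, M.eRk X ≤ 4 → X.ncard ≤ 7 := fun X hX hr => by
      have := S2.ncard_le_of_eRk_le_of_not_nullity M 4 9 (by norm_num) h4 hX (r := 4) (by norm_num) (by exact_mod_cast hr)
      omega
    have hU := topCount_le_flat M 16 8 (by norm_num) hR hn hfree 8 7 hflat hflat' (by norm_num) (by norm_num)
      13 99 651 hs3 hs4 hs5
    norm_num [Finset.sum_range_succ, Nat.choose] at hU
    have hUq : (Matroid.topCount M 16 5 : ℚ) ≤ 151561 := by linarith
    exact_mod_cast hUq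

/-- The tail side of the cell `(16, 8)` on the caps `13 / 99 / 651`: `T = 1,557,443 ≤ 96·2^24/1024`. -/
theorem tail_sixteen_eight :
    1024 * ((((16 + 8).choose 4 : ℚ) +
      (∑ j ∈ Finset.range 6, (Nat.choose (min 5 ((8 + 3) / 2 + 1 - 2)) j : ℚ) / (((j + 1) + 3 * (j + 1).choose 2 + 3 * (j + 1).choose 3 + 2 * (j + 1).choose 4 : ℕ) : ℚ)) *
        ((13 * (16 + 8 - 3).choose 2 + 99 * (16 + 8 - 4) + 651 : ℕ) : ℚ) +
      ((∑ j ∈ Finset.range 6, (Nat.choose 5 j : ℚ) / (((j + 1) + 3 * (j + 1).choose 2 + 3 * (j + 1).choose 3 + 2 * (j + 1).choose 4 : ℕ) : ℚ)) -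
        (∑ j ∈ Finset.range 6, (Nat.choose (min 5 ((8 + 3) / 2 + 1 - 2)) j : ℚ) / (((j + 1) + 3 * (j + 1).choose 2 + 3 * (j + 1).choose 3 + 2 * (j + 1).choose 4 : ℕ) : ℚ))) *
        ((10 : ℕ).choose 5 : ℚ)) +
      (((16 + 8).choose 3 * 2 ^ 3 + (16 + 8).choose 2 * 2 + (16 + 8) + 1 : ℕ) : ℚ) +
      (((16 + 8).choose 5 : ℚ) + (∑ j ∈ Finset.range (8), (Nat.choose (min 13 ((8 + 6) / 2 + 1 - 2)) j : ℚ) / (((j + 1) + 3 * (j + 1).choose 2 + 3 * (j + 1).choose 3 + 2 * (j + 1).choose 4 : ℕ) : ℚ)) * ((13 * (16 + 8 - 3).choose 3 + 99 * (16 + 8 - 4).choose 2 + 651 * (16 + 8 - 5) + (8 + 5).choose 6 : ℕ) : ℚ) +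
        ((∑ j ∈ Finset.range (8), (Nat.choose (min 19 (5 + 8) - 6) j : ℚ) / (((j + 1) + 3 * (j + 1).choose 2 + 3 * (j + 1).choose 3 + 2 * (j + 1).choose 4 : ℕ) : ℚ)) - (∑ j ∈ Finset.range (8), (Nat.choose (min 13 ((8 + 6) / 2 + 1 - 2)) j : ℚ) / (((j + 1) + 3 * (j + 1).choose 2 + 3 * (j + 1).choose 3 + 2 * (j + 1).choose 4 : ℕ) : ℚ))) *
        ((min 19 (5 + 8)).choose 6 : ℚ)) +
      ((∑ j ∈ Finset.range (8 + 1), (16 + 8).choose j : ℕ) : ℚ)) ≤ (96 : ℚ) * 2 ^ (16 + 8) := by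
  have hsm : (∑ j ∈ Finset.range (8), (Nat.choose (min 13 ((8 + 6) / 2 + 1 - 2)) j : ℚ) / (((j + 1) + 3 * (j + 1).choose 2 + 3 * (j + 1).choose 3 + 2 * (j + 1).choose 4 : ℕ) : ℚ)) = 414767 / 103635 := by
    norm_num [Finset.sum_range_succ, Nat.choose]
  have hsg : (∑ j ∈ Finset.range (8), (Nat.choose (min 19 (5 + 8) - 6) j : ℚ) / (((j + 1) + 3 * (j + 1).choose 2 + 3 * (j + 1).choose 3 + 2 * (j + 1).choose 4 : ℕ) : ℚ)) = 6418141 / 1184400 := by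
    norm_num [Finset.sum_range_succ, Nat.choose]
  have hs4m : (∑ j ∈ Finset.range 6, (Nat.choose (min 5 ((8 + 3) / 2 + 1 - 2)) j : ℚ) / (((j + 1) + 3 * (j + 1).choose 2 + 3 * (j + 1).choose 3 + 2 * (j + 1).choose 4 : ℕ) : ℚ)) = 523 / 225 := by
    norm_num [Finset.sum_range_succ, Nat.choose]
  have hs4g : (∑ j ∈ Finset.range 6, (Nat.choose 5 j : ℚ) / (((j + 1) + 3 * (j + 1).choose 2 + 3 * (j + 1).choose 3 + 2 * (j + 1).choose 4 : ℕ) : ℚ)) = 12767 / 4230 := by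
    norm_num [Finset.sum_range_succ, Nat.choose]
  rw [hsm, hsg, hs4m, hs4g]
  simp only [Finset.sum_range_succ, Finset.sum_range_zero]
  norm_num [Nat.choose]

/-- **THE CELL `(16, 8)` OF THE `q = 5` WINDOW**: `RLS M 16 5` for every finite `e`-free matroid of rank `16` on `24` points
(the nested dichotomy; caps `13 / 99 / 651`, slack `96/1024`, `Φ(16, 5) ≤ 2^21/20905`). -/
theorem c025_core_five_sixteen_eight (M : Matroid α) [M.Finite]
    (hR : M.eRank = ((16 : ℕ) : ℕ∞)) (hn : M.E.ncard = 16 + 8)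
    (hfree : ∀ e ∈ M.E, ∃ A ⊆ M.E \ {e}, e ∉ M.closure A ∧ e ∉ M.closure ((M.E \ {e}) \ A)) : RLS M 16 5 := by
  classical
  have hd : M.E.encard = M.eRank + ((8 : ℕ) : ℕ∞) := by
    rw [hR, ← M.ground_finite.cast_ncard_eq, hn]
    push_cast
    ring
  obtain ⟨hs3, hs4, hs5⟩ := caps_sixteen_eight M hd hfree
  have hU := topCount_le_sixteen_eight M hR hn hfree
  have hΦ : phiK 16 5 ≤ (2 : ℚ) ^ (16 + 5) / ((20905 : ℕ) : ℚ) := by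
    rw [S2.phiK_sixteen_five]; norm_num
  rw [RLS_iff]
  exact c025_core_five_cell_of_topCount_xqictq5g M 16 8 (by norm_num) hR hn hfree 13 99 651 hs3 hs4 hs5 151561 hU
    20905 (by norm_num) (phiK 16 5) hΦ ⟨96, by norm_num, by norm_num [Nat.choose], tail_sixteen_eight⟩

end ThmN

end PercRepro
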